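import Mathlib
import HarnessLib
import Summits.NavierStokesRegularity.NavierStokesRegularity.Theses.BarrierStepRungThree
import Summits.NavierStokesRegularity.NavierStokesRegularity.Theorems.BarrierStepRungThreeWindowCertificateMarginPolyEvalContDiff
import Summits.NavierStokesRegularity.NavierStokesRegularity.Theorems.BarrierStepRungThreeBarrierCertificateGlue
import Summits.NavierStokesRegularity.NavierStokesRegularity.Theorems.BarrierStepRungThreeDisturbanceAbsorption

/-!
# `BarrierStepRungThree`, LINE g2-2: the polynomial window certificate implies the window
certificate with margin and the barrier certificate

The registered birth skeleton of crux `WindowCertificateMargin` (item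
stmt-NavierStokesRegularity-23648) composes STUB 1 = the route item `PolynomialWindowCertificate`
(stmt-NavierStokesRegularity-23942: clock/barrier `v` and goal `g` are evaluations of real
multivariate polynomials of total degree ≤ 8 / ≤ 4 in the window coordinates, the two regularity
clauses dropped) with STUB 2 (`WindowCertificateMargin.stub_polyEval_contDiff`, landed: polynomial
evaluation along the window-coordinate map is `C¹`). This file lands that composition as tree
theorems, so that a proof of `PolynomialWindowCertificate` closes, by `exact`, both
`WindowCertificateMargin` (via `windowCertificateMargin_of_polynomialWindowCertificate`) and the
parent crux `BarrierCertificate` (via the landed glue `barrierCertificateGlue_proof` and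
`disturbanceAbsorption_proof`: `barrierCertificate_of_polynomialWindowCertificate`).

HONEST FRAMING: pure clause plumbing between items of one route on class rung TL-M3 (a statement
about MODEL lattice tables in Tao's class E₂(R)); the load-bearing existential
`PolynomialWindowCertificate` is NOT proved here, and nothing in this file is a statement about the
Navier–Stokes equations — NS regularity is not proved by any of this.
-/

-- the sub-problem namespace `Summit.NavierStokesRegularity.NavierStokesRegularity` repeats the summit name by design (D-0017)
set_option linter.dupNamespace false

namespace Summit.NavierStokesRegularity.NavierStokesRegularity.Theorems

open Summit.NavierStokesRegularity.NavierStokesRegularity.Theses.BarrierStepRungThree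

/-- **Skeleton composition, landed**: a polynomial window certificate (item
stmt-NavierStokesRegularity-23942) is a window certificate with margin (item
stmt-NavierStokesRegularity-23648). The data are copied verbatim; the clauses `ContDiff ℝ 1 v` and
`Continuous g` come from `WindowCertificateMargin.stub_polyEval_contDiff` after rewriting `v`, `g`
as polynomial evaluations. -/
theorem windowCertificateMargin_of_polynomialWindowCertificate
    (h : PolynomialWindowCertificate) : WindowCertificateMargin := by
  obtain ⟨R, θ, c, η, γ, M, i₀, α, X₀, n, kLo, v, g, r, q, ρ, env, Ψ, Φ, win, vf, Λ,
    ⟨pv, pg, _hpv, _hpg, hv, hg⟩, h0, h1, h2, h3, h4, h5, h6, h7, h8, h9, h10, h11, h14, h15, h16,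
    h17, h18, h19, h20, h21, h22, h23, h24, h25, h26, h27⟩ := h
  have hvC : ContDiff ℝ 1 v := by
    have e : v = fun x => MvPolynomial.eval (fun ij : Fin 4 × Fin n => x ij.1 ij.2) pv := funext hv
    rw [e]
    exact WindowCertificateMargin.stub_polyEval_contDiff n pv
  have hgC : Continuous g := by
    have e : g = fun x => MvPolynomial.eval (fun ij : Fin 4 × Fin n => x ij.1 ij.2) pg := funext hg
    rw [e]
    exact WindowCertificateMargin.polyEval_continuous n pg
  exact ⟨R, θ, c, η, γ, M, i₀, α, X₀, n, kLo, v, g, r, q, ρ, env, Ψ, Φ, win, vf, Λ, h0, h1, h2, h3,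
    h4, h5, h6, h7, h8, h9, h10, h11, hvC, hgC, h14, h15, h16, h17, h18, h19, h20, h21, h22, h23,
    h24, h25, h26, h27⟩

/-- **Down to the parent crux**: a polynomial window certificate (item
stmt-NavierStokesRegularity-23942) yields the barrier certificate `BarrierCertificate` (item
stmt-NavierStokesRegularity-23420), through `WindowCertificateMargin` and the landed glue
`BarrierCertificateGlue` + `DisturbanceAbsorption`. -/
theorem barrierCertificate_of_polynomialWindowCertificate
    (h : PolynomialWindowCertificate) : BarrierCertificate :=
  barrierCertificateGlue_proof (windowCertificateMargin_of_polynomialWindowCertificate h)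
    disturbanceAbsorption_proof

/-- The same one level up, stated from the margin certificate: `WindowCertificateMargin` (item
stmt-NavierStokesRegularity-23648) alone yields `BarrierCertificate` (item
stmt-NavierStokesRegularity-23420), the support `DisturbanceAbsorption` being a theorem. -/
theorem barrierCertificate_of_windowCertificateMargin
    (h : WindowCertificateMargin) : BarrierCertificate :=
  barrierCertificateGlue_proof h disturbanceAbsorption_proof

end Summit.NavierStokesRegularity.NavierStokesRegularity.Theorems
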